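import Summits.AnomalousDissipation.AnomalousDissipation.Theorems.SolenoidalFractalHomogenisationLagrangianStepD1ResidueCertPair
import Summits.AnomalousDissipation.AnomalousDissipation.Theorems.SolenoidalFractalHomogenisationLagrangianStepD1ResidueGlue
import HarnessLib

/-!
# D1 residue certificate (CERT-(i) v0, variant A) — part 3/3: denominator, finite core, the certificate `relSmall_pairQS`, glue to clause (i)

DENOMINATOR `L̄(k,p) ≤ symb (excQS cubatureWord MB S)(k,p)` on the sectorial block window from the landed first-order pinch
`OddGain.evenPinch_excQS_design_point'` (charge 3 %) + `gainForm_div` + the three point enclosures `lC_c ≤ 0.97·f_{T_c}(11/10)`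
(`slotWeight_mono`, `le_slotWeight_half`, `pi_sq_bounds`); FINITE CORE `N̄ ≤ ρP·L̄` on `p ⊥ k` (`slotCoef_mul_sq`, `slot_sum_poly`,
`I3_eq_of_perp`, `I1_le_I2_of_perp`; two rational sign conditions); COMPOSITION `relSmall_pairQS : RelSmall (pairQS S) (excQS … S) (115/10⁶)`;
GLUE over the LANDED `RelSmall` algebra (`RelSmall.smul` of `…WCrossingWindow`, `RelSmall.add` of `…WCrossingRelSmallAlgebra` p687315, packaged as
`WCrossing.relSmall_residue_of_pair_tail` / `WCrossing.D1Residue_of_pair_tail(_unit)` in `…D1ResidueGlue`; planner p5's scratch copies `RelSmall.smul'`/`RelSmall.add'`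
are dropped per ruling D26-9 (γ)): `clause_i_of_pair_tail`, `clause_i_of_tail` (p5's texts) — clause (i) of `D1ExactFamily (ΦB a) ρB MB MB_pos` for any
family `Ψ` from the TAIL bound `RelSmall (Ψ ν S − ΦB a S − a•pairQS S) (ΦB a S) (ρB − ρP)`, `ρB − ρP = 5/10⁶` — and the REGISTRY-v16 SHAPES
`D1Residue_of_tail : (∀ a > 0, ∀ ν ∈ Ioc 0 νB₁, … → RelSmall (ΨB₁ a ν S − ΦB a S − a • pairQS S) (ΦB a S) (ρB − ρP)) → <stub_D1_residue text verbatim>`,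
`D1Residue_of_tail_unit` (unit-normalisation tail data relative to `excQS`, `ρP + ρT ≤ ρB`).  REMAINING for `stub_D1_residue` (p1 g12 lane A1/A4):
the tail statement for the named family `ΨB₁ a`.

Port note (prover ad-k1loc-p3 g8, CERT-(i)-LAND, ruling D26-9): §§ Denominator / Finite core / Composition are planner ad-ideate-p5's texts verbatim
(crux spine v3 `Cruxes/LagrangianRenormalisationStep/Lines/onelevel_D1_residue_cert.lean`, sha12 7c5da58463df, sorry-free; pre-cut port); §5 re-derived
over the landed algebra + the two registry shapes.  No sorry, no named fact, no definition.  NOT a proof of `stub_D1_residue`, K1L_D or AD; rung F-D1.A0.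
-/

set_option linter.dupNamespace false

namespace Summit.AnomalousDissipation.AnomalousDissipation.Theorems.SolenoidalFractalHomogenisation.LagrangianStep.D1ResidueCert

open Summit.AnomalousDissipation.AnomalousDissipation.Theorems
open Summit.AnomalousDissipation.AnomalousDissipation.Theorems.SolenoidalFractalHomogenisation.LagrangianStep
open Summit.AnomalousDissipation.AnomalousDissipation.Theorems.SolenoidalFractalHomogenisation.LagrangianStep.WCrossing
open Summit.AnomalousDissipation.AnomalousDissipation.Theorems.SolenoidalFractalHomogenisation.LagrangianStep.WEvenCert
open Literature.Analysis Literature.Analysis.FluidPDE Literature.Analysis.FunctionSpaces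
open Set Real

noncomputable section

/-! ## Denominator -/

/-- Generic lower point enclosure at `a = 11/10` with the 3 % charge: monotonicity of `ϑ(½,·)` + `le_slotWeight_half` at a rational `X_lo ≥ 30`. -/
private theorem encl_aux {c Xlo L : ℝ} (hXlo30 : 30 ≤ Xlo) (hXlo : Xlo ≤ c * π ^ 2)
    (hL : L ≤ 97 / 100 * ((1 / 3 - 4 / Xlo ^ 2 + 12 / Xlo ^ 3 - 16 * (1 / (27 / 10 : ℝ) ^ 15) / Xlo ^ 3) / (11 / 10))) :
    L ≤ 97 / 100 * (slotWeight (1 / 2) (c * π ^ 2) / (11 / 10)) := by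
  have hm := slotWeight_mono (ρ := 1 / 2) (by norm_num) le_rfl (by linarith) hXlo
  have hlow := le_slotWeight_half hXlo30
  refine hL.trans ?_
  gcongr
  exact hlow.trans hm


/-- **The three lower point enclosures** `lC_c ≤ (97/100)·f_{T_c}(11/10)`: `X = T_c·11/10 = (88/25)π², (2816/125)π², (8019/125)π² ≥ 34.74, 222.3, 633.1`. -/
theorem lEncl : ∀ j : Fin 26, lC j ≤ 97 / 100 * qsRespScalar cubatureWord.ramp (slotT j) (11 / 10) := by
  intro j
  show lC j ≤ 97 / 100 * qsRespScalar (1 / 2) (4 * Real.pi ^ 2 * ‖Torus.latticeVec (slots j).m‖ ^ 2 * MB * ((slots j).τ : ℝ)) (11 / 10)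
  rw [norm_sq_m, show (4 * Real.pi ^ 2 * Mq (slots j) * MB * ((slots j).τ : ℝ)) = Tj j from rfl]
  obtain ⟨hlo, -⟩ := pi_sq_bounds
  rcases slot_class j with hj | hj | hj
  · obtain ⟨hM, hTj, -⟩ := facts100 j hj
    have hl : lC j = 2911 / 10000 := by unfold lC byClass; rw [hM]; norm_num
    rw [hl, hTj]; unfold T100 MB
    rw [qsRespScalar_eq_slotWeight_div (by norm_num : (11 / 10 : ℝ) ≠ 0),
      show 4 * π ^ 2 * 1 * (1 / 50 : ℝ) * 40 * (11 / 10) = 88 / 25 * π ^ 2 by ring]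
    exact encl_aux (Xlo := 3474 / 100) (by norm_num) (by nlinarith) (by norm_num)
  · obtain ⟨hM, hTj, -, -, -, -⟩ := facts110 j hj
    have hl : lC j = 2937 / 10000 := by unfold lC byClass; rw [hM]; norm_num
    rw [hl, hTj]; unfold T110 MB
    rw [qsRespScalar_eq_slotWeight_div (by norm_num : (11 / 10 : ℝ) ≠ 0),
      show 4 * π ^ 2 * 2 * (1 / 50 : ℝ) * 128 * (11 / 10) = 2816 / 125 * π ^ 2 by ring]
    exact encl_aux (Xlo := 2223 / 10) (by norm_num) (by nlinarith) (by norm_num)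
  · obtain ⟨hM, hTj, -⟩ := facts111 j hj
    have hl : lC j = 2938 / 10000 := by unfold lC byClass; rw [hM]; norm_num
    rw [hl, hTj]; unfold T111 MB
    rw [qsRespScalar_eq_slotWeight_div (by norm_num : (11 / 10 : ℝ) ≠ 0),
      show 4 * π ^ 2 * 3 * (1 / 50 : ℝ) * 243 * (11 / 10) = 8019 / 125 * π ^ 2 by ring]
    exact encl_aux (Xlo := 6331 / 10) (by norm_num) (by nlinarith) (by norm_num)


/-- `|P_j p|²` in the `gainForm_div` vocabulary. -/
theorem PpSq_eq' (j : Fin 26) (p : Fin 3 → ℝ) :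
    PpSq j p = ∑ i, p i ^ 2 - (∑ i, p i * mhat (cubatureWord.phase j) i) ^ 2 := by
  unfold PpSq; exact sum_sq_projPerp_mulVec (sum_mhat_sq _) p


/-- **(D) THE DENOMINATOR BOUND** `L̄(k,p) ≤ symb (excQS S)(k,p)` on the sectorial block window: the landed first-order sectorial pinch at the
design point, slot by slot, with the point enclosures `lEncl`. -/
theorem excDenBound (S : T4) (hS : Torus.NearIso S (10 / 11) (11 / 10)) {τ : ℝ} (hτ : τ ∈ Set.Icc (0:ℝ) (1 / 20)) (hodd : OddSectorial S τ)
    (k p : Fin 3 → ℝ) : Lbar k p ≤ Torus.symb (excQS cubatureWord MB S) k p := by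
  have h := (OddGain.evenPinch_excQS_design_point' (Mlag := MB) (le_of_eq rfl) ⟨hτ.1, hτ.2.trans (by norm_num)⟩ hS hodd k p).1
  refine le_trans ?_ h
  rw [gainForm_div cubatureWord MB (by norm_num : (11 / 10 : ℝ) ≠ 0) k p, Finset.mul_sum]
  unfold Lbar
  refine Finset.sum_le_sum fun j _ => ?_
  have hw : 0 ≤ slotCoef cubatureWord j * ek j k ^ 2 * PpSq j p :=
    mul_nonneg (mul_nonneg (slotCoef_nonneg _ _) (sq_nonneg _)) (PpSq_nonneg j p)
  have hEj := lEncl j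
  unfold slotT at hEj
  calc slotCoef cubatureWord j * ek j k ^ 2 * (lC j * PpSq j p)
      = (slotCoef cubatureWord j * ek j k ^ 2 * PpSq j p) * lC j := by ring
    _ ≤ (slotCoef cubatureWord j * ek j k ^ 2 * PpSq j p) *
          (97 / 100 * qsRespScalar cubatureWord.ramp
            (4 * Real.pi ^ 2 * ‖Torus.latticeVec (cubatureWord.phase j).m‖ ^ 2 * MB * (cubatureWord.phase j).τ) (11 / 10)) :=
        mul_le_mul_of_nonneg_left hEj hw
    _ = _ := by rw [PpSq_eq']; unfold ek; ring

/-! ## Finite core -/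

/-- `A ≤ rB ⇒ A/C ≤ r(B/C)` for `C > 0`. -/
private theorem div_le_mul_div {A B C r : ℝ} (h : A ≤ r * B) (hC : 0 < C) : A / C ≤ r * (B / C) := by
  rw [← mul_div_assoc]; exact div_le_div_of_nonneg_right h hC.le


/-- **(C) THE FINITE CORE** `N̄ ≤ ρP·L̄` on transverse pairs — two rational sign conditions after the `O_h` reduction `slot_sum_poly`. -/
theorem coreIneq (k p : Fin 3 → ℝ) (hp : ∑ i, p i * k i = 0) : Nbar k p ≤ ρP * Lbar k p := by
  have hCpos : (0:ℝ) < 2 * (2 * π) ^ 4 * 3720 := by positivity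
  have hk : ∀ j, slotCoef cubatureWord j * ek j k ^ 2 = kCoef (slots j) k / (2 * (2 * π) ^ 4 * 3720) := fun j => by
    unfold ek; exact slotCoef_mul_sq j k
  have hsum : ∀ X1 X2 X3 : ℝ, ∑ j, slotCoef cubatureWord j * ek j k ^ 2 * (byClass X1 X2 X3 (Mq (slots j)) * PpSq j p)
      = ((80 * X1 + 192 * (X2 / 2) + 144 * (X3 / 3) + 64 * 0) * I1 k p + (40 * X1 + 160 * (X2 / 2) + 144 * (X3 / 3) + 32 * 0) * I2 k p
          + (64 * (X2 / 2) + 72 * (X3 / 3)) * I3 k p) / (2 * (2 * π) ^ 4 * 3720) := by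
    intro X1 X2 X3
    rw [← slot_sum_poly X1 (X2 / 2) (X3 / 3) 0 k p, Finset.sum_div]
    refine Finset.sum_congr rfl fun j _ => ?_
    rw [byClass_mul_PpSq, hk j]; ring
  have hN : Nbar k p = _ := hsum (93 / 1000000) (36 / 100000000) (16 / 1000000000)
  have hL : Lbar k p = _ := hsum (2911 / 10000) (2937 / 10000) (2938 / 10000)
  rw [hN, hL, I3_eq_of_perp hp]
  refine div_le_mul_div ?_ hCpos
  have h1 := I1_nonneg k p
  have h2 := I1_le_I2_of_perp hp
  unfold ρP
  nlinarith [h1, h2]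

/-! ## Composition -/

/-- **CERT-(i) v0 — THE CERTIFICATE**: the pair-memory term is `RelSmall` of size `ρP = 115/10⁶` relative to the quasi-static excess on the
sectorial block window `NearIso S (10/11) (11/10)`, `OddSectorial S τ`, `τ ≤ 1/20`. -/
theorem relSmall_pairQS :
    ∀ S : T4, Torus.NearIso S (10 / 11) (11 / 10) → ∀ τ ∈ Set.Icc (0:ℝ) (1 / 20), OddSectorial S τ →
      RelSmall (pairQS S) (excQS cubatureWord MB S) ρP := by
  intro S hS τ hτ hodd k p q hp hq
  have h1 := pairNumBound S hS k p q
  have hρ : (0:ℝ) ≤ ρP := by unfold ρP; norm_num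
  have hSp : Nbar k p ≤ ρP * Torus.symb (excQS cubatureWord MB S) k p :=
    (coreIneq k p hp).trans (mul_le_mul_of_nonneg_left (excDenBound S hS hτ hodd k p) hρ)
  have hSq : Nbar k q ≤ ρP * Torus.symb (excQS cubatureWord MB S) k q :=
    (coreIneq k q hq).trans (mul_le_mul_of_nonneg_left (excDenBound S hS hτ hodd k q) hρ)
  calc (Torus.bsymb (pairQS S) k p q) ^ 2 ≤ Nbar k p * Nbar k q := h1
    _ ≤ (ρP * Torus.symb (excQS cubatureWord MB S) k p) * (ρP * Torus.symb (excQS cubatureWord MB S) k q) :=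
        mul_le_mul hSp hSq (Nbar_nonneg k q) ((Nbar_nonneg k p).trans hSp)
    _ = ρP ^ 2 * (Torus.symb (excQS cubatureWord MB S) k p * Torus.symb (excQS cubatureWord MB S) k q) := by ring

/-! ## §5 Glue to clause (i) over the landed `RelSmall` algebra: assembly with the tail, registry-v16 shapes -/

/-- `0 ≤ ρP`. [folklore] -/
theorem ρP_nonneg : (0:ℝ) ≤ ρP := by unfold ρP; norm_num

/-- `ρP ≤ ρB` (`115/10⁶ ≤ 120/10⁶`; tail allowance `ρB − ρP = 5/10⁶`). [folklore] -/
theorem ρP_le_ρB : ρP ≤ ρB := by unfold ρP ρB; norm_num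

/-- ASSEMBLY OF CLAUSE (i): if the pair term is certified at `ρP` and the remainder of the exact family after removing
`ΦB a S + a • pairQS S` (the TAIL: non-adjacent memory, period wrap, identification residue) is `RelSmall` of size `ρB − ρP`
relative to `ΦB a S`, then clause (i) of `D1ExactFamily (ΦB a) ρB MB MB_pos` holds for `Ψ` (planner p5's text; proof via the landed
`WCrossing.relSmall_residue_of_pair_tail` = `RelSmall.smul` + `RelSmall.add` + `transNonneg_ΦB`). -/
theorem clause_i_of_pair_tail {Ψ : ℝ → T4 → T4} {a : ℝ} (ha : 0 ≤ a)
    (hP : ∀ S : T4, Torus.NearIso S (10 / 11) (11 / 10) → ∀ τ ∈ Set.Icc (0:ℝ) (1 / 20), OddSectorial S τ →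
      RelSmall (pairQS S) (excQS cubatureWord MB S) ρP)
    (hT : ∀ ν : ℝ, ∀ S : T4, Torus.NearIso S (10 / 11) (11 / 10) → ∀ τ ∈ Set.Icc (0:ℝ) (1 / 20), OddSectorial S τ →
      RelSmall (Ψ ν S - ΦB a S - a • pairQS S) (ΦB a S) (ρB - ρP)) :
    ∀ ν : ℝ, ∀ S : T4, Torus.NearIso S (10 / 11) (11 / 10) → ∀ τ ∈ Set.Icc (0:ℝ) (1 / 20), OddSectorial S τ →
      RelSmall (Ψ ν S - ΦB a S) (ΦB a S) ρB := by
  intro ν S hS τ hτ hodd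
  exact WCrossing.relSmall_residue_of_pair_tail ha ρP_nonneg ρP_le_ρB hP hS hτ hodd (hT ν S hS τ hτ hodd)

/-- The same with the pair certificate discharged: clause (i) of `D1ExactFamily (ΦB a) ρB MB MB_pos` from the TAIL bound ALONE
(planner p5's text). -/
theorem clause_i_of_tail {Ψ : ℝ → T4 → T4} {a : ℝ} (ha : 0 ≤ a)
    (hT : ∀ ν : ℝ, ∀ S : T4, Torus.NearIso S (10 / 11) (11 / 10) → ∀ τ ∈ Set.Icc (0:ℝ) (1 / 20), OddSectorial S τ →
      RelSmall (Ψ ν S - ΦB a S - a • pairQS S) (ΦB a S) (ρB - ρP)) :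
    ∀ ν : ℝ, ∀ S : T4, Torus.NearIso S (10 / 11) (11 / 10) → ∀ τ ∈ Set.Icc (0:ℝ) (1 / 20), OddSectorial S τ →
      RelSmall (Ψ ν S - ΦB a S) (ΦB a S) ρB :=
  clause_i_of_pair_tail ha relSmall_pairQS hT

/-- **Registry-v16 shape**: the registered `stub_D1_residue` text VERBATIM follows from the TAIL bound for the named family `ΨB₁ a`
(`RelSmall (ΨB₁ a ν S − ΦB a S − a • pairQS S) (ΦB a S) (ρB − ρP)` on the block window for every `a > 0`, `ν ∈ (0, νB₁]`); the pair
certificate `relSmall_pairQS` is discharged here (glue `WCrossing.D1Residue_of_pair_tail`).  Registry v17 reads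
`stub_D1_residue := D1ResidueCert.D1Residue_of_tail stub_D1_residueTail`. -/
theorem D1Residue_of_tail
    (hT : ∀ a > (0:ℝ), ∀ ν ∈ Set.Ioc 0 νB₁, ∀ S : T4, Torus.NearIso S (10 / 11) (11 / 10) →
      ∀ τ ∈ Set.Icc (0:ℝ) (1 / 20), OddSectorial S τ →
        RelSmall (ΨB₁ a ν S - ΦB a S - a • pairQS S) (ΦB a S) (ρB - ρP)) :
    ∀ a > (0:ℝ), ∀ ν ∈ Set.Ioc 0 νB₁, ∀ S, Torus.NearIso S (10 / 11) (11 / 10) →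
      ∀ τ ∈ Set.Icc (0:ℝ) (1 / 20), OddSectorial S τ →
        RelSmall (ΨB₁ a ν S - ΦB a S) (ΦB a S) ρB :=
  WCrossing.D1Residue_of_pair_tail ρP_nonneg ρP_le_ρB relSmall_pairQS hT

/-- **Registry-v16 shape, unit-normalisation data**: a tail bound `RelSmall (psiStar ν S − excQS S − pairQS S) (excQS S) ρT` on the block
window for `ν ∈ (0, νB₁]` with `0 ≤ ρT`, `ρP + ρT ≤ ρB` (e.g. `ρT = 1/200000`) gives the registered `stub_D1_residue` text for EVERY `a > 0`
(the stub is `a`-free: `ΨB₁ a ν S − ΦB a S = a • (psiStar ν S − excQS S)`; glue `WCrossing.D1Residue_of_pair_tail_unit`). -/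
theorem D1Residue_of_tail_unit {ρT : ℝ} (hT0 : 0 ≤ ρT) (hle : ρP + ρT ≤ ρB)
    (hT : ∀ ν ∈ Set.Ioc 0 νB₁, ∀ S : T4, Torus.NearIso S (10 / 11) (11 / 10) →
      ∀ τ ∈ Set.Icc (0:ℝ) (1 / 20), OddSectorial S τ →
        RelSmall (Sideband.psiStar cubatureWord MB MB_pos ν S - excQS cubatureWord MB S - pairQS S) (excQS cubatureWord MB S) ρT) :
    ∀ a > (0:ℝ), ∀ ν ∈ Set.Ioc 0 νB₁, ∀ S, Torus.NearIso S (10 / 11) (11 / 10) →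
      ∀ τ ∈ Set.Icc (0:ℝ) (1 / 20), OddSectorial S τ →
        RelSmall (ΨB₁ a ν S - ΦB a S) (ΦB a S) ρB :=
  WCrossing.D1Residue_of_pair_tail_unit ρP_nonneg hT0 hle relSmall_pairQS hT

end

end Summit.AnomalousDissipation.AnomalousDissipation.Theorems.SolenoidalFractalHomogenisation.LagrangianStep.D1ResidueCert
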